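import Summits.BirchSwinnertonDyer.Rank1Residual.X12.O11.RamifiedEllipticUnitMechanism
import Summits.BirchSwinnertonDyer.BirchSwinnertonDyer.Theorems.RamifiedSevenEllipticUnitsIndexIffBsdpAnyPrime
import Summits.BirchSwinnertonDyer.BirchSwinnertonDyer.Theorems.RamifiedSevenEllipticUnitsStubD11
import Summits.BirchSwinnertonDyer.BirchSwinnertonDyer.Theorems.RamifiedSevenEllipticUnitsMechanismBridge
import Summits.BirchSwinnertonDyer.BirchSwinnertonDyer.Theorems.RamifiedSevenEllipticUnitsStrictTorsionContent
import HarnessLib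

set_option linter.dupNamespace false

/-!
# Route `RamifiedSevenEllipticUnits` (rung K7r): the rev-8 VALUE piece (R-PR)|IMC@`p` — the route item
# `EllipticUnitValueSeven` (stmt-BirchSwinnertonDyer-19705) at `p = 7` — is EQUIVALENT to
# `BSD(W, p)` modulo the IMC piece — at EVERY CM-ramified prime; the IMC piece is a FINITE-LEVEL index
# statement modulo GZK; and the relative witness of the value piece at `5929e1`

Cell `bsd-cm`, seat `bsd-cm-k7r-c4` (g4). HONEST FRAMING: nothing here closes an item; BSD is not proved
by any of this. Companion of `X12/O11/RamifiedEllipticUnitMechanism.lean` (STEP A″: the carrier-based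
pieces (R-IMC) `RamifiedCMEllipticUnitIMCAt`, (R-PR) `RamifiedCMBottomClassIndexLawAt`, existence
`RamifiedCMBottomClassExistsAt`, and the seams) and of `…StrictControlAnyPrime` / `…IndexIffBsdpAnyPrime`
((R-ctrl) a theorem, (R-tors) ⟸ GZK, (R-EU)@p ⟺ BSD_p at every ramified prime).

## §1 VALUE ⟺ BSD_p modulo IMC (J's T1 reading made exact, every CM-ramified prime)
* `ramifiedCMBottomClassIndexLawAt_of_bsdp` — BSD(W,p) ⟹ (R-PR)|IMC@p (r_an ≤ 1; no IMC piece needed);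
* `bsdp_of_ramifiedCMBottomClassIndexLawAt_of_imc` — (R-PR)@p ⟹ BSD(W,p) granted existence ∧ (R-IMC);
* `ramifiedCMBottomClassIndexLawAt_iff_bsdp_of_imc` — the equivalence at analytic rank one.
So wherever BSD_p(W) is certified (Route U at p = 7: 25/26 classes N < 5·10⁵ modulo print binders) the
value law cannot carry an extra power of `p` unless the IMC identity fails AS TYPED: J's key risk for the
attacked piece is located in the IMC transcription (normalisation of `c`), not in BSD.
## §2 The relative witness `stub_ellipticUnitValueSeven_D11` (value piece at `5929e1 = 49a1^{(−11)}`
⟸ Route U's displayed print binders alone; regime: inside Route U — disclosed).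
## §3 `ramifiedCMEllipticUnitIMCAt_iff_bottomIndex` — (R-IMC)@p ⟺ «c = log_p #Sel_str(W)[p^∞] +
log_p #Sel_str(W')[p^∞]» (no Iwasawa module), granted GZK.

References: [BurungaleKobayashiNakamuraOta2026] Thm. 3.14 (3), Thm. 7.2, §1.4 (arXiv:2608.06879; shape
only); [KrizLi2019] Thm. 1.20, Rem. 3.10; [Miller2011LMS] Def. 1.1; [GreenbergLNM1716] §3–§4.
-/

noncomputable section

open scoped Classical

open WeierstrassCurve NumberField IsDedekindDomain Field
  Literature.NumberTheory.EllipticCurves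
  Literature.NumberTheory.EllipticCurves.Rank1Residual
  Literature.NumberTheory.EllipticCurves.BurungaleKobayashiNakamuraOta2026
  Literature.NumberTheory.GaloisRepresentations
  Summit.BirchSwinnertonDyer.Rank1Residual.Additive

namespace Summit.BirchSwinnertonDyer.BirchSwinnertonDyer.Theorems.RamifiedSevenEllipticUnits

open Summit.BirchSwinnertonDyer.Rank1Residual Summit.BirchSwinnertonDyer.Rank1Residual.X12.O11
  Summit.BirchSwinnertonDyer.BirchSwinnertonDyer.Theses.RamifiedSevenEllipticUnits
  Summit.BirchSwinnertonDyer.BirchSwinnertonDyer.Rank1Residual.EllipticUnitMechanismBridge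

section AnyPrime

variable {W : WeierstrassCurve ℚ} [W.IsElliptic] [W.IsGloballyMinimal] {p : ℕ} [Fact p.Prime]

/-- **`BSD(W, p)` ⟹ (R-PR)|IMC at `W`**, granted Cassels, modularity and GZK (analytic rank `≤ 1`):
the converse seam `ramifiedCMBottomClassIndexLawAt_of_indexAt` fed with (R-EU) from `BSD(W, p)`
(`ramifiedCMEllipticUnitIndexAt_of_bsdp`) and (R-tors) from GZK (`ramifiedCMStrictTorsionAt_of_GZK`);
NO IMC piece is needed in this direction. So wherever `BSD(W, p)` is certified (Route U at `p = 7`: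
25/26 classes of conductor `< 5·10⁵`, modulo its print binders) the relative value law HOLDS outright.
[cite: Miller2011LMS, Def. 1.1 (arXiv:1010.2431 p. 3)] [cite: Cassels1965ArithmeticVIII] -/
theorem ramifiedCMBottomClassIndexLawAt_of_bsdp (hCassels : bsdRHS_eq_of_isIsogenous)
    (hmod : hasEntireLFunction_rat) (hGZK : rank_eq_analyticRank_of_analyticRank_le_one)
    (hr : W.analyticRank ≤ 1) (hB : BSDp W p) : RamifiedCMBottomClassIndexLawAt W p :=
  ramifiedCMBottomClassIndexLawAt_of_indexAt (ramifiedCMEllipticUnitIndexAt_of_bsdp hCassels hmod hGZK hr hB)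
    (ramifiedCMStrictTorsionAt_of_GZK hGZK W p)

/-- **(R-PR)|IMC ⟹ `BSD(W, p)` at analytic rank one, granted (R-IMC)∃** and the four named facts: the
seam `ramifiedCMEllipticUnitIndexAt_of_imc_of_indexLaw` then
`bsdp_of_ramifiedCMEllipticUnitIndexAt_of_analyticRank_eq_one`. [cite: Miller2011LMS, Def. 1.1 (arXiv:1010.2431 p. 3)] -/
theorem bsdp_of_ramifiedCMBottomClassIndexLawAt_of_imc (hmod : hasEntireLFunction_rat)
    (hGZ : GrossZagier1986_thm_I_7_3) (hGZK : rank_eq_analyticRank_of_analyticRank_le_one)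
    (hCassels : bsdRHS_eq_of_isIsogenous) (h1 : RamifiedCMEllipticUnitIMCAt W p) (hCM : W.HasCM)
    (hram : CMRamified W p) (h5 : 5 ≤ p) (hr : W.analyticRank = 1)
    (h2 : RamifiedCMBottomClassIndexLawAt W p) : BSDp W p :=
  bsdp_of_ramifiedCMEllipticUnitIndexAt_of_analyticRank_eq_one hmod hGZ hGZK hCassels hCM hram h5 hr
    (ramifiedCMEllipticUnitIndexAt_of_imc_of_indexLaw h1 h2)

/-- **The VALUE piece (R-PR)|IMC at `(W, p)` ⟺ `BSD(W, p)`** for every globally minimal CM curve of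
analytic rank one at its CM-ramified prime `p ≥ 5`, modulo (R-IMC)∃ and the four named facts
{modularity, GZ I.(7.3), GZK, Cassels} — J's T1 reading made exact at every ramified prime: the key risk
«extra power of `p`» can only live in the IMC transcription (normalisation of the class), never where
`BSD(W, p)` is certified. [cite: Miller2011LMS, Def. 1.1 (arXiv:1010.2431 p. 3)]
[cite: BurungaleKobayashiNakamuraOta2026, Thm. 3.14 (3) and §1.4 (arXiv:2608.06879; shape only)] -/
theorem ramifiedCMBottomClassIndexLawAt_iff_bsdp_of_imc (hmod : hasEntireLFunction_rat)
    (hGZ : GrossZagier1986_thm_I_7_3) (hGZK : rank_eq_analyticRank_of_analyticRank_le_one)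
    (hCassels : bsdRHS_eq_of_isIsogenous) (h1 : RamifiedCMEllipticUnitIMCAt W p) (hCM : W.HasCM)
    (hram : CMRamified W p) (h5 : 5 ≤ p) (hr : W.analyticRank = 1) :
    RamifiedCMBottomClassIndexLawAt W p ↔ BSDp W p :=
  ⟨bsdp_of_ramifiedCMBottomClassIndexLawAt_of_imc hmod hGZ hGZK hCassels h1 hCM hram h5 hr,
    ramifiedCMBottomClassIndexLawAt_of_bsdp hCassels hmod hGZK hr.le⟩

/-- **(R-IMC)∃ ⟺ the bottom-layer index statement**, granted GZK: «at every analytic-rank-one frame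
some datum's bottom index exponent `c` equals `log_p #Sel_str(W/ℚ)[p^∞] + log_p #Sel_str(W'/ℚ)[p^∞]`»
(= `log_p #Sel_𝔭(K, E[p^∞])` by the twist-descent count) — NO Iwasawa module on the right: exact
control (R-ctrl) is a theorem (`ramifiedCMStrictControlAt_holds`), (R-tors) follows from GZK, and the
Mordell–Weil data the control identity is guarded by exist under GZK (`exists_generator_with_level`,
`prime_nsmul_eq_zero_padic_of_hasCM_of_cmRamified`). [cite: GreenbergLNM1716, §3 Thm. 1.2 and §4 Lemma 4.2]
[cite: BurungaleKobayashiNakamuraOta2026, Thm. 3.14 (3) (arXiv:2608.06879; shape only)] -/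
theorem ramifiedCMEllipticUnitIMCAt_iff_bottomIndex (hGZK : rank_eq_analyticRank_of_analyticRank_le_one) :
    RamifiedCMEllipticUnitIMCAt W p ↔
      ∀ (K : Type) [Field K] [NumberField K] (𝔭 : HeightOneSpectrum (𝓞 K))
        (W' : WeierstrassCurve ℚ) [W'.IsElliptic] [W'.IsGloballyMinimal] (C : VariableChange ℚ),
        IsFrame W p K 𝔭 W' C → W.analyticRank = 1 →
        ∀ (κ : ZpExtension K p), κ.IsAnticyclotomic →
          ∀ (γ : absoluteGaloisGroup K) [Fact (κ.IsTopGenerator γ)],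
            ∃ (ι : PadicAlgCl p ≃+* ℂ) (φ : HeckeCharacter K) (Ω : ℂ) (𝓔 : AcDualExpSystem W p K 𝔭 κ ι)
              (D : EllipticUnitClassData W p K 𝔭 κ γ ι φ Ω 𝓔) (c : ℕ), D.HasBottomIndexExp c ∧
              c = padicValNat p (Nat.card ↥(strictSelmerPInfty W p)) +
                padicValNat p (Nat.card ↥(strictSelmerPInfty W' p)) := by
  have hctrl := ramifiedCMStrictControlAt_holds W p
  have htors := ramifiedCMStrictTorsionAt_of_GZK hGZK W p
  have hdata : ∀ (K : Type) [Field K] [NumberField K] (𝔭 : HeightOneSpectrum (𝓞 K))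
      (W' : WeierstrassCurve ℚ) [W'.IsElliptic] [W'.IsGloballyMinimal] (C : VariableChange ℚ),
      IsFrame W p K 𝔭 W' C → W.analyticRank = 1 →
      ∃ (P : W.toAffine.Point) (n : ℕ) (P' : W'.toAffine.Point) (n' : ℕ), ¬ IsOfFinAddOrder P ∧
        (∀ R : W.toAffine.Point, ∃ (k : ℤ) (T : W.toAffine.Point), IsOfFinAddOrder T ∧ R = k • P + T) ∧
        (∀ Q : (W.baseChange ℚ_[p]).toAffine.Point, p • Q = 0 → Q = 0) ∧
        (∃ Q : (W.baseChange ℚ_[p]).toAffine.Point, p ^ n • Q = W.toPadicPoint p P) ∧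
        (∀ Q : (W.baseChange ℚ_[p]).toAffine.Point, p ^ (n + 1) • Q ≠ W.toPadicPoint p P) ∧
        ¬ IsOfFinAddOrder P' ∧
        (∀ R : W'.toAffine.Point, ∃ (k : ℤ) (T : W'.toAffine.Point),
          IsOfFinAddOrder T ∧ R = k • P' + T) ∧
        (∀ Q : (W'.baseChange ℚ_[p]).toAffine.Point, p • Q = 0 → Q = 0) ∧
        (∃ Q : (W'.baseChange ℚ_[p]).toAffine.Point, p ^ n' • Q = W'.toPadicPoint p P') ∧
        (∀ Q : (W'.baseChange ℚ_[p]).toAffine.Point, p ^ (n' + 1) • Q ≠ W'.toPadicPoint p P') := by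
    intro K _ _ 𝔭 W' _ _ C hF hr
    have hp : p.Prime := Fact.out
    have hCM : W.HasCM := hF.1
    have hram : CMRamified W p := hF.2.1
    have h5 : 5 ≤ p := hF.2.2.1
    have hiso : IsIsogenous W W' := isIsogenous_of_isFrame hF
    have hrank : W.mordellWeilRank = 1 := by rw [(hGZK W hr.le).1, hr]
    have hr' : W'.analyticRank = 1 := by rw [← analyticRank_eq_of_isIsogenous' hiso, hr]
    have hrank' : W'.mordellWeilRank = 1 := by rw [(hGZK W' hr'.le).1, hr']
    obtain ⟨P, n, hP, hgen, hdiv, hndiv⟩ := exists_generator_with_level W p hrank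
    obtain ⟨P', n', hP', hgen', hdiv', hndiv'⟩ := exists_generator_with_level W' p hrank'
    have hCM' : W'.HasCM := X12.hasCM_of_isIsogenous hiso hCM
    have hram' : CMRamified W' p := by
      change (p : ℤ) ∣ cmFieldDiscrOfJ W'.j
      rw [← X12.cmFieldDiscrOfJ_eq_of_isIsogenous hiso hCM]
      exact hram
    exact ⟨P, n, P', n', hP, hgen, prime_nsmul_eq_zero_padic_of_hasCM_of_cmRamified W p hCM h5 hram,
      hdiv, hndiv, hP', hgen', prime_nsmul_eq_zero_padic_of_hasCM_of_cmRamified W' p hCM' h5 hram',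
      hdiv', hndiv'⟩
  constructor
  · intro hIMC K _ _ 𝔭 W' _ _ C hF hr κ hκ γ _
    obtain ⟨⟨n₀, hchar⟩, hfin⟩ := htors K 𝔭 W' C hF hr κ hκ γ
    obtain ⟨P, n, P', n', hP, hgen, ht, hdiv, hndiv, hP', hgen', ht', hdiv', hndiv'⟩ :=
      hdata K 𝔭 W' C hF hr
    obtain ⟨ι, φ, Ω, 𝓔, D, c, hc, himc⟩ := hIMC K 𝔭 W' C hF hr κ hκ γ
    refine ⟨ι, φ, Ω, 𝓔, D, c, hc, ?_⟩
    have e1 := himc n₀ hchar hfin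
    have e2 := hctrl K 𝔭 W' C hF hr κ hκ γ P n P' n' hP hgen ht hdiv hndiv hP' hgen' ht' hdiv' hndiv'
      n₀ hchar hfin
    have : (c : ℤ) = padicValNat p (Nat.card ↥(strictSelmerPInfty W p)) +
        padicValNat p (Nat.card ↥(strictSelmerPInfty W' p)) := by rw [← e1, e2]
    exact_mod_cast this
  · intro hFL K _ _ 𝔭 W' _ _ C hF hr κ hκ γ _
    obtain ⟨P, n, P', n', hP, hgen, ht, hdiv, hndiv, hP', hgen', ht', hdiv', hndiv'⟩ :=
      hdata K 𝔭 W' C hF hr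
    obtain ⟨ι, φ, Ω, 𝓔, D, c, hc, hcval⟩ := hFL K 𝔭 W' C hF hr κ hκ γ
    refine ⟨ι, φ, Ω, 𝓔, D, c, hc, fun n₀ hchar hfin => ?_⟩
    have e2 := hctrl K 𝔭 W' C hF hr κ hκ γ P n P' n' hP hgen ht hdiv hndiv hP' hgen' ht' hdiv' hndiv'
      n₀ hchar hfin
    rw [e2, hcval]
    push_cast
    ring

end AnyPrime

section WitnessD11

open Literature.NumberTheory.EllipticCurves.KrizLi2019 Literature.NumberTheory.EllipticCurves.ModularForms

/-- **Relative witness for the rev-8 VALUE piece at the unit-case member `5929e1 = 49a1^{(−11)}`: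
(R-PR)|IMC@7 at `W` ⟸ Route U's displayed print binders** (KL19 Thm 1.20 + Rem 3.10, Rubin 1983 Thm C,
BG85, GZ/Kolyvagin data, GZK, modularity, Cassels): the parent's witness
`stub_ellipticUnitIndexSeven_D11` (ram, p413532) with its `hctrl` binder DISCHARGED by
`ramifiedCMStrictControlAt_holds W 7`, turned into the relative value law by the converse seam
`ramifiedCMBottomClassIndexLawAt_of_indexAt` with (R-tors) from GZK — no IMC hypothesis. Regime: inside
Route U's (unit case) — disclosed. [cite: KrizLi2019, Thm. 1.20 and Rem. 3.10] [cite: Cassels1965ArithmeticVIII]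
[cite: Miller2011LMS, §1 and Def. 1.1 (arXiv:1010.2431 p. 3)] -/
theorem stub_ellipticUnitValueSeven_D11
    (W : WeierstrassCurve ℚ) [W.IsElliptic] [W.IsGloballyMinimal] [NeZero (W.conductorNorm ℤ)]
    (hKL : KrizLi2019.thm120_padicLogHeegner_unit_of_bernoulli)
    (hRem : KrizLi2019.rem310_padicLogHeegner_integral)
    (hW : ∃ C : VariableChange ℚ, C • W = cm7.quadraticTwist ((-(11 : ℕ) : ℤ) : ℚ))
    (K : Type) [Field K] [NumberField K] [NeZero (NumberField.discr K).natAbs]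
    (hK : IsImaginaryQuadratic K) (hdK : NumberField.discr K = -(19 : ℕ))
    (D : ModularParametrizationData W (W.conductorNorm ℤ))
    (H : HeegnerDatum (W.conductorNorm ℤ) (NumberField.discr K)) (ι : K →+* ℂ) (ιp : K →+* ℚ_[7])
    (P : (W.baseChange K).toAffine.Point)
    (hGZ : gross_zagier (W.conductorNorm ℤ) W K) (hKo : kolyvagin (W.conductorNorm ℤ) W K)
    (hGZK : rank_eq_analyticRank_of_analyticRank_le_one) (hmod : hasEntireLFunction_rat)
    (hP : WeierstrassCurve.Affine.Point.map ι.toRatAlgHom P = heegnerPointComplex D H)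
    (hr1 : W.analyticRank = 1)
    (hLt : (W.quadraticTwist (NumberField.discr K : ℚ)).entireLFunction 1 ≠ 0)
    (Wd : WeierstrassCurve ℚ) [Wd.IsElliptic] [Wd.IsGloballyMinimal] (Cd : VariableChange ℚ)
    (hWd : Cd • W.quadraticTwist (NumberField.discr K : ℚ) = Wd)
    (hBF : bsdTriple_of_hasCM_of_L_one_ne_zero)
    (hu : padicValRat 7 (Cd.u : ℚ) = 0)
    (hC : Rubin1983.thmC_seven_quadraticField)
    (hBG : BuhlerGross1985.firstDescent_seven_oddTwist_of_bernoulli)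
    [Finite (AddCommGroup.torsion (W.baseChange K).toAffine.Point)]
    (crd : (W.baseChange K).toAffine.Point →+ ℤ) (g : (W.baseChange K).toAffine.Point)
    (hg : crd g = 1) (hker : ∀ x, crd x = 0 → IsOfFinAddOrder x)
    (hc7 : ¬ ((7 : ℤ) ∣ D.c)) (hCassels : bsdRHS_eq_of_isIsogenous) :
    RamifiedCMBottomClassIndexLawAt W 7 :=
  haveI : Fact (Nat.Prime 7) := ⟨by norm_num⟩
  ramifiedCMBottomClassIndexLawAt_of_indexAt
    (stub_ellipticUnitIndexSeven_D11 W (ramifiedCMStrictControlAt_holds W 7) hKL hRem hW K hK hdK D H ι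
      ιp P hGZ hKo hGZK hmod hP hr1 hLt Wd Cd hWd hBF hu hC hBG crd g hg hker hc7 hCassels)
    (ramifiedCMStrictTorsionAt_of_GZK hGZK W 7)

end WitnessD11

/-- **IMC piece + VALUE piece + `PublishedFactsSeven` ⟹ the rung leaf `X12.CMRamifiedSeven`** — the
rev-8 `closes` previewed: the bridge's `ellipticUnitIndexAt_seven_of_imc_of_value` gives crux #2
`EllipticUnitIndexSeven`, and k7r-c3's `cmRamifiedSeven_of_ellipticUnitIndexSeven` (cruxes #3/#4 and the
frame data already theorems modulo the facts) gives the leaf. [cite: Miller2011LMS, Def. 1.1] -/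
theorem cmRamifiedSeven_of_imc_of_value_of_publishedFacts
    (h₁ : ∀ (W : WeierstrassCurve ℚ) [W.IsElliptic] [W.IsGloballyMinimal] [Fact (Nat.Prime 7)],
      X12.ClassCSeven W → RamifiedCMEllipticUnitIMCAt W 7)
    (h₂ : ∀ (W : WeierstrassCurve ℚ) [W.IsElliptic] [W.IsGloballyMinimal] [Fact (Nat.Prime 7)],
      X12.ClassCSeven W → RamifiedCMBottomClassIndexLawAt W 7)
    (h₅ : PublishedFactsSeven) : X12.CMRamifiedSeven :=
  cmRamifiedSeven_of_ellipticUnitIndexSeven (ellipticUnitIndexAt_seven_of_imc_of_value h₁ h₂) h₅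

end Summit.BirchSwinnertonDyer.BirchSwinnertonDyer.Theorems.RamifiedSevenEllipticUnits

end
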